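import Summits.RiemannHypothesis.RiemannHypothesis.Theorems.HandoffDodgerCeiling
import Summits.RiemannHypothesis.RiemannHypothesis.Theorems.HandoffDodgerUpperClause
import Summits.RiemannHypothesis.RiemannHypothesis.Theorems.SoloInformedGroundStateZeroSide
import Summits.RiemannHypothesis.RiemannHypothesis.Theorems.HandoffCeilingRateSmallC
import HarnessLib

/-!
# HANDOFF — the dodger wall ceiling reduced to ZERO SUMS versus a COLLAR (rh-explicit, track «HANDOFF», seat prove-2 gen8, ATTEMPT-16 §8)

HONEST FRAMING. Nothing here bears on the truth of RH: the objects are UPPER bounds on the wall offset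
`δ*(q) = a*(S_{<q}) − (log q)/2` (`HandoffMarginLaw.wallOffset`). ATTEMPT-15 (gen7) typed the target
`DodgerWallCeiling C q₀` (`δ*(q) ≤ C·(log q)^{3/2}·q^{−3/2}` for all primes `q ≥ q₀`) and reduced it to a
`SubwindowWitnessFamily C q₀` (`HandoffDodgerCeiling`, p376851). ATTEMPT-16 (gen8, HOME/handoff/prove-2/ATTEMPT-16.md) proves that
family at paper level (DERIVED, with `C = 1/50`, `q₀ = 10⁴`; every step written) from two inequalities about an explicit mollified
zero-dodger `θ`: (C) for every `T`, the truncated zero sum `Σ_{ρ : |Im ρ| ≤ T} m(ρ)‖(θ(·−δ) − θ(·+δ))^(ρ)‖²` is at most an explicit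
`B_q`, and (D) `B_q < (2 log q/√q)·Re k_θ(log q − 2δ)`. THIS FILE is the kernel side of that assembly: it proves that (C)+(D) for all
large consecutive primes IS a sub-window witness family (`subwindowWitnessFamily_of_zeroSumFamily`) — by the tree's unconditional
zero-side domination `re_weilQuadratic_le_of_zeroSum_le` (explicit formula + Bessel pairing, `SoloInformedGroundStateZeroSide`) — and records
the resulting ceiling and RH-free upper clause (`dodgerWallCeiling_of_zeroSumFamily`, `upperClause_of_zeroSumFamily`). It also TYPES the
paper theorem's exact claim (`DodgerZeroSumClaim`, a `Prop`; NOT proved in Lean) so that its two consequences are kernel statements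
CONDITIONAL on that one named `Prop`. No `sorry`, no axiom beyond the standard three, no claim beyond the reduction.

References (as printed): E. Bombieri, Rend. Mat. Acc. Lincei (9) 11 (2000) Thm 2, §4 [`Bombieri2000Weil`]; E. Hasanalizade, Q. Shen,
P.-J. Wong, J. Number Theory 235 (2022) 219–241, Cor. 1.2 (the counting input of ATTEMPT-16; tree `zetaZeroCount_hasanalizade_shen_wong`).
-/

set_option linter.dupNamespace false

noncomputable section

open Complex Filter Set MeasureTheory Literature.NumberTheory.LFunctions
open Summit.RiemannHypothesis.RiemannHypothesis.Theorems.MotivicDoor.SemilocalThreshold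
open Summit.RiemannHypothesis.RiemannHypothesis.Theorems.HandoffMarginLaw (wallOffset)
open Summit.RiemannHypothesis.RiemannHypothesis.Theorems.HandoffDecomposition (nextPrime consecutivePrimes_nextPrime)
open scoped Real Topology

namespace Summit.RiemannHypothesis.RiemannHypothesis.Theorems.Handoff

/-- **The ZERO-SUM form of a sub-window witness family** at scale `C·(log q)^{3/2}·q^{−3/2}` from `q₀` on: for all consecutive primes
`q < q′` with `q ≥ q₀`, a Weil test function `θ` supported in the `q`-subwindow `[−(log q)/2, (log q)/2]`, a shift
`0 ≤ δ ≤ C(log q)^{3/2}q^{−3/2}` inside the window, and a bound `B` for EVERY truncated zero sum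
`Σ_{ρ ∈ weilZeroIndex T} m(ρ)‖Ĝ_δ(ρ)‖²` of the translate pair `G_δ = θ(·−δ) − θ(·+δ)` that is STRICTLY below the weighted collar
`(2 log q/√q)·Re k_θ(log q − 2δ)`. ATTEMPT-16 §4 (Lemma C) and §5 (Lemma D) prove exactly this, with `C = 1/50`, `q₀ = 10⁴`, for the
mollified zero-dodger. [this track, ATTEMPT-16 §6] -/
def SubwindowZeroSumFamily (C : ℝ) (q₀ : ℕ) : Prop :=
  ∀ q q' : ℕ, ConsecutivePrimes q q' → q₀ ≤ q →
    ∃ θ : ℝ → ℂ, ∃ δ B : ℝ, IsWeilTest θ ∧ tsupport θ ⊆ Icc (-(Real.log q / 2)) (Real.log q / 2) ∧ 0 ≤ δ ∧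
      δ ≤ C * Real.log q ^ (3 / 2 : ℝ) * (q : ℝ) ^ (-(3 / 2 : ℝ)) ∧ Real.log q / 2 + δ ≤ Real.log q' / 2 ∧
      (∀ T : ℝ, ∑ᶠ ρ ∈ weilZeroIndex T,
          (riemannZetaZeroOrder ρ : ℝ) * ‖weilMellin (fun x ↦ θ (x - δ) - θ (x + δ)) ρ‖ ^ 2 ≤ B) ∧
      B < 2 * Real.log q / Real.sqrt q * (weilConv θ (weilReflect θ) (Real.log q - 2 * δ)).re

/-- **Zero sums below the collar give the witness family (THEOREM).** The full-form energy `Re Q(G_δ)` is at most every uniform bound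
`B` of the truncated zero sums `Σ_{|Im ρ| ≤ T} m(ρ)‖Ĝ_δ(ρ)‖²` (tree `re_weilQuadratic_le_of_zeroSum_le`: the explicit formula and the
pairing `ρ ↔ 1 − ρ̄`, no hypothesis on the zeros), so `B <` collar gives the witness inequality of `SubwindowWitnessFamily`.
[this track, ATTEMPT-16 §6 (THEOREM 16.1 (iii))] -/
theorem subwindowWitnessFamily_of_zeroSumFamily {C : ℝ} {q₀ : ℕ} (h : SubwindowZeroSumFamily C q₀) :
    SubwindowWitnessFamily C q₀ := by
  intro q q' hqq' hq₀
  obtain ⟨θ, δ, B, hθ, hθs, hδ, hδC, hwin, hB, hlt⟩ := h q q' hqq' hq₀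
  exact ⟨θ, δ, hθ, hθs, hδ, hδC, hwin,
    (re_weilQuadratic_le_of_zeroSum_le (isWeilTest_translatePair hθ δ) hB).trans_lt hlt⟩

/-- **… hence the exponent-3/2 wall ceiling** (with gen7's `dodgerWallCeiling_of_subwindowWitnessFamily`). RH-free; upper bounds on
walls only. [this track, ATTEMPT-16 §6] -/
theorem dodgerWallCeiling_of_zeroSumFamily {C : ℝ} {q₀ : ℕ} (h : SubwindowZeroSumFamily C q₀) :
    DodgerWallCeiling C q₀ :=
  dodgerWallCeiling_of_subwindowWitnessFamily (subwindowWitnessFamily_of_zeroSumFamily h)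

/-- **… and the RH-free UPPER CLAUSE with no gap hypothesis**: a zero-sum family at scale `C(log q)^{3/2}q^{−3/2}` from `q₀` on gives
`a*(S_{<q}) < (log q⁺)/2` for every prime `q ≥ max(q₀, 3)` once `|C| ≤ 7/100` (theory-2's `ceiling_rate_lt_of_abs_le`: the rate sits
inside every prime window from `q = 3` on). [this track, ATTEMPT-16 §6 COROLLARY 16.3] -/
theorem upperClause_of_zeroSumFamily {C : ℝ} {q₀ q : ℕ} (h : SubwindowZeroSumFamily C q₀) (hC : |C| ≤ 7 / 100)
    (hq : q.Prime) (hq₀ : q₀ ≤ q) (hq3 : 3 ≤ q) :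
    weilSemilocalThreshold (Nat.primesBelow q) < Real.log (nextPrime q) / 2 := by
  have h1 := dodgerWallCeiling_of_zeroSumFamily h q hq hq₀
  have h2 := HandoffCeilingRateSmallC.ceiling_rate_lt_of_abs_le (C := C) hq3 hC
  have h3 := log_half_add_le_log_nextPrime_half (q := q) (by omega)
  simp only [wallOffset] at h1
  linarith

/-- **TYPED CLAIM of ATTEMPT-16 THEOREM 16.2 (paper-level DERIVED; NOT proved in Lean): the mollified zero-dodgers form a zero-sum
family with `C = 1/50` from `q₀ = 10⁴` on.** The paper proof (HOME/handoff/prove-2/ATTEMPT-16.md §1–§6) uses only: the explicit formula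
in the form `re_weilQuadratic_le_of_zeroSum_le`, the counting bound `zetaZeroCount_hasanalizade_shen_wong` and `zetaZeroCount_fourteen`,
`0 < Re ρ < 1` with the symmetry `ρ ↦ 1 − ρ̄`, finite trigonometric algebra (the dodger is a cosine polynomial cut off at `±b`, its
transform an explicit entire function vanishing at the first `K ≈ e·q·log q` zeros), Stirling's bounds, partial summation, and one
interval-arithmetic table for the special function `I₀(Y) = ∫₀^Y Φ(u²)Φ((Y−u)²)du`, `Φ(x) = Σ xⁿ/(n!(2n)!)`. Taking `(h : DodgerZeroSumClaim)`
makes a theorem CONDITIONAL on this (the gate records it); discharging it in Lean is several sessions of Mellin/partial-summation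
bookkeeping (ATTEMPT-16 §8). [this track, ATTEMPT-16 THEOREM 16.2] -/
def DodgerZeroSumClaim : Prop := SubwindowZeroSumFamily (1 / 50) 10000

/-- Under the typed claim: `δ*(q) ≤ (1/50)(log q)^{3/2}q^{−3/2}` for every prime `q ≥ 10⁴`. [this track, ATTEMPT-16 THEOREM 16.2] -/
theorem dodgerWallCeiling_one_div_fifty (h : DodgerZeroSumClaim) : DodgerWallCeiling (1 / 50) 10000 :=
  dodgerWallCeiling_of_zeroSumFamily h

/-- Under the typed claim: the upper clause `a*(S_{<q}) < (log q⁺)/2` for every prime `q ≥ 10⁴`, RH-free and gap-free.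
[this track, ATTEMPT-16 COROLLARY 16.3] -/
theorem upperClause_of_dodgerZeroSumClaim (h : DodgerZeroSumClaim) {q : ℕ} (hq : q.Prime) (hq₀ : 10000 ≤ q) :
    weilSemilocalThreshold (Nat.primesBelow q) < Real.log (nextPrime q) / 2 :=
  upperClause_of_zeroSumFamily h (by norm_num [abs_of_pos]) hq hq₀ (by omega)

end Summit.RiemannHypothesis.RiemannHypothesis.Theorems.Handoff
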